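import Summits.QuantumFields.YangMills.Theorems.FluctuationComparisonRegPrIntLRunpairOrganFibreLawDefs
import Summits.QuantumFields.YangMills.Theorems.FluctuationComparisonRegPrIntLRunpairOrganFibreLawJDefs
import HarnessLib

/-!
# Crux `FluctuationComparisonRegPrIntL` (stmt-QuantumFields-20520, rung R3), PATH-B organ — THE PROJECTION `SpreadFibreLawHJ → SpreadFibreLawH`
# (the Jensen superset row implies the FROZEN LIN row), DEFINITION-FREE

Cell `ym3-torus` (YM ladder rung R3 = continuum `SU(2)` Yang–Mills on the three-torus — a RUNG: NOT d = 4, NOT infinite volume, NOT a mass gap, NOT Clay).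
Width seat `ym3-torus-px19` (gen 20), LEAD w3 g26 №3 (B) first refusal; `--kind proof --supports stmt-QuantumFields-20520 --as helper`, count-neutral,
no registry ∕ binder ∕ `Lines/` edit, default heartbeats, `autoImplicit false`.

WHAT.  ★`spreadFibreLawH_of_spreadFibreLawHJ : SpreadFibreLawHJ → SpreadFibreLawH`.  `SpreadFibreLawHJ` (ideator ym-r3-idea-1 g28, `Cruxes/…/FibreLawHJ.lean` v0.2; Theorems-side DEF `…RunpairOrganFibreLawJDefs` by LEAD w3 g26, one decl over ✓(b)'s `mwCut`∕`wNum`∕`wgt` ((HV′) block by px5 g20, LEAD DESIGN CALL №33),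
def body ws16 3bd44078399401c2) is `SpreadFibreLawH` v0.3m (LEAD w3 g26 «FROZEN LIN EDITION», `Theorems/…RunpairOrganFibreLawDefs.lean`, def body ws16
833268b9e6d569c4, ✓p812742) with EXACTLY four insertions and no other change: head letters `NV1 NV2 NV3 NV4 : ℝ`, tail schedules `δV1 δV2 δV3 δV4 : ℕ → ℝ`, ONE packed
facts conjunct before `j₀ ≤ j₁`, and ONE stride conjunct [12b] «(HV)» right after the (H) block [12].  Hence the projection is a RE-PACK: the head pattern drops
`NV• δV•` and the facts component, the stride pattern drops the trailing (HV) component; nothing is estimated.  (Design: LEAD w3 g26 DESIGN CALL №32 (d) ∕ ★★OWNER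
RULING №73 (iii): the Jensen edition is a SUPERSET ROW in a separate file so that the LIN landing never waits on it; px5 g19 JVAR-KNIT DOCKING LIST a6079895 §2.)

USE.  With LEAD's ✓`…OrganTangentTangentHOfSpreadFibreLaw.tangentH_of_spreadFibreLawH : SpreadFibreLawH → ⟨LIN″⟩` this gives ⟨LIN″⟩ from the Jensen row alone, so a
consumer holding `hFJ : SpreadFibreLawHJ` feeds BOTH Taylor halves of BRICK 1 v2.2 (`oneStepTransportUH_of_tangentH_jensenH`) from ONE chart:
`tangentH_of_spreadFibreLawH (spreadFibreLawH_of_spreadFibreLawHJ hFJ)` for `hL`, and LEAD's Jensen knit (`SpreadFibreLawHJ → JVARᵘ-H″`, pending) ∘ px5's ✓E2E v2.2 for `hJ`.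

HONEST FRAMING: quantifier re-packing between two HYPOTHESIS rows; nothing of Bałaban's analysis is asserted or proved; `SpreadFibreLawH`, `SpreadFibreLawHJ`, LIN″, JEN″,
JVARᵘ-H″, O1ᵘ-H v2.2, S1aᴴ, S3ᴴ, S2α′, S2β, 26243, the five registered stubs, crux 20520 `FluctuationComparisonRegPrIntL` and `YM3TorusSU2` are NOT proved; no summit ∕
sub-problem statement is proved; registry `Lines/semiclassical_s2beta.lean` 3732b7df untouched; rung R3 = SU(2) YM₃ on T³ at fixed lattice data — NOT d = 4, NOT infinite
volume, NOT a mass gap, NOT Clay; the Yang–Mills mass gap is NOT proved.  [folklore]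
-/

set_option autoImplicit false

noncomputable section

namespace Summit.QuantumFields.YangMills.Theorems.OrganTangentSpreadFibreLawHOfHJ

open Summit.QuantumFields.YangMills.Theorems.FluctuationComparisonRegPrIntLRunpairOrganFibreLaw (SpreadFibreLawH)
open Summit.QuantumFields.YangMills.Theorems.FluctuationComparisonRegPrIntLRunpairOrganFibreLawJ (SpreadFibreLawHJ)

/-- ★ **THE PROJECTION**: the Jensen superset row `SpreadFibreLawHJ` implies the frozen LIN row `SpreadFibreLawH` — re-pack, dropping the head letters
`NV1…NV4`, the schedules `δV1…δV4` with their packed facts conjunct, and the trailing stride conjunct [12b] (HV). [folklore] -/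
theorem spreadFibreLawH_of_spreadFibreLawHJ (hFJ : SpreadFibreLawHJ) : SpreadFibreLawH := by
  obtain ⟨pW, γ₁, hγ₁, h⟩ := hFJ
  refine ⟨pW, γ₁, hγ₁, ?_⟩
  intro F γ hγ hγ1 b₀ p₀ j₀ prm η rA Bρ hb₀ hp₀ hpW hadm hη0 hηs hηss hηt hrA
  obtain ⟨κ₀, hκ₀, h⟩ := h F γ hγ hγ1 b₀ p₀ j₀ prm η rA Bρ hb₀ hp₀ hpW hadm hη0 hηs hηss hηt hrA
  refine ⟨κ₀, hκ₀, ?_⟩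
  intro κ hκ hκle
  obtain ⟨rc, w₀, NT, NX, NL, CJ, NV1, NV2, NV3, NV4, δT, δX, δL, δV1, δV2, δV3, δV4, j₁, hrc, hw₀, hNT, hNX, hNL, hCJ, hδ0,
    hδTs, hδTss, hδTt, hδXs, hδXss, hδXt, hδLs, hδLss, hδLt, -, hj₁, h⟩ := h κ hκ hκle
  refine ⟨rc, w₀, NT, NX, NL, CJ, δT, δX, δL, j₁, hrc, hw₀, hNT, hNX, hNL, hCJ, hδ0, hδTs, hδTss, hδTt, hδXs, hδXss, hδXt,
    hδLs, hδLss, hδLt, hj₁, ?_⟩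
  intro ν hG hCν K K' hKK' Ts T hTs hTK μ μ' ρ ρ' hanch hcut hcons hfin hwin j hj1 hjTs
  obtain ⟨Z, instZ, τ, Φ, J, S, π, hτ, hΦm, hJm, hSm, hS, hsec, hdis, hcont, hJle, hpos, hπ1, hπ2, hH, -⟩ :=
    h ν hG hCν K K' hKK' Ts T hTs hTK μ μ' ρ ρ' hanch hcut hcons hfin hwin j hj1 hjTs
  exact ⟨Z, instZ, τ, Φ, J, S, π, hτ, hΦm, hJm, hSm, hS, hsec, hdis, hcont, hJle, hpos, hπ1, hπ2, hH⟩

end Summit.QuantumFields.YangMills.Theorems.OrganTangentSpreadFibreLawHOfHJ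

end
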